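import Summits.Ventures.LatticeQCDFlow.Scoring.ProductHaarSlices
import Summits.Ventures.LatticeQCDFlow.Scoring.SU2TorusRectangleSites
import Summits.Ventures.LatticeQCDFlow.Scaling.PlaquetteIndependence2D
import Literature.MathematicalPhysics.QuantumFieldTheory.TorusLoopReflection
import HarnessLib

/-!
# The exact non-abelian area law in two dimensions for EVERY compact gauge group, I: one-link peeling, column absorption, and the column Stokes identity

HONEST FRAMING: exact (Metropolis-corrected) sampling algorithms for lattice gauge theory;
figures of merit are autocorrelation/cost numbers at stated couplings and volumes; no
continuum-physics claim.

Venture `LatticeQCDFlow` (cell pub-lqcd), sub-topic `Scoring`; FANOUT row 5 (`s0-sun-a`), GEN-18.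
NEW WORK of the cell (placement rule); part I of the lead's NOT-TYPED item "general-`N` free-boundary area
law for `N ≥ 3`" — done for EVERY compact second-countable group `G`, every continuous matrix
representation `ρ : G →* M_N(ℂ)` and every continuous weight `w`, WITHOUT characters, Peter–Weyl or gauge
fixing; part II (`Scoring/NonabelianAreaLaw2DWilsonLoop.lean`) assembles the area law
`∫ ρ(W_{R×T})_{ab} ∏_{p} w(U_p) dHaar^{⊗E} = (M^{RT})_{ab}`, `M = ∫ ρ(g) w(g) dg`, from the three tools here.

Setting (the tree's torus vocabulary, `Literature…ConstructiveQFTWave0`): links `Edge 2 L` of `(ℤ/L)²`,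
configurations `GaugeConfig 2 L G`, product Haar measure `Haar^{⊗E}`
(`Measure.pi fun _ => haarProbability G`), plaquette holonomies `plaquetteHolonomy U p 0 1`, the
rectangular loop `rectangleHolonomy U (i,j) 0 1 R T` with corner `(i, j)` (bottom line, right line, top
line reversed, left line reversed).

* §1 **`integral_comp_link_mul_eq`** (and `integral_comp_link_inv_mul_eq`) — ONE-LINK PEELING: if `Φ`,
  `A`, `B` do not depend on the link `e`, then `∫ f(A·U_e·B)·Φ dHaar^{⊗E} = (∫ f dHaar)·∫ Φ dHaar^{⊗E}`
  (resp. with `U_e⁻¹`): conditionally on the other links `A·U_e·B` is Haar distributed — two-sided and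
  inversion invariance of the Haar probability of a compact group, via row 5 GEN-10's Bochner slicing
  `integral_pi_eq_integral_update`;
* §2 **`integral_listProd_words_mul`** — ABSORBING A COLUMN: for words `A_c·U_{e_c}·B_c` in DISTINCT
  private links `e_c`, `c < T`, whose coefficients `A_c, B_c`, a matrix factor `K` and a scalar factor `Ψ`
  ignore every private link, and every continuous `ρ`, `w`:
  `∫ ((∏_{c<T} ρ(A_c U_{e_c} B_c))·K)_{ab} · (∏_{c<T} w(A_c U_{e_c} B_c)) · Ψ = ∫ (M^T·K)_{ab} · Ψ`,
  `M_{kl} = ∫ ρ(g)_{kl} w(g) dg` (induction on `T`, peeling `e_0` by §1, entrywise matrix algebra);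
* §3 **`rectangleHolonomy_succ_eq_listProd_mul`** — the COLUMN STOKES IDENTITY (pure group algebra, any
  group): `W_{(R+1)×T} = [∏_{b<T} (P Γ_b h_b)·v'_b·(h_{b+1}⁻¹ v_b⁻¹ Γ_b⁻¹ P⁻¹)]·W_{R×T}`, `P` the bottom
  line, `Γ_b` the left line of the new column up to height `b`, `h_b`, `v_b`, `v'_b` the bottom, left and
  right links of the plaquette at `(i+R, j+b)`: each factor is that plaquette's holonomy transported to the
  corner, `(PΓ_b)·U_{(i+R,j+b)}·(PΓ_b)⁻¹`, as a word in its right link `v'_b = U_{(i+R+1, j+b),1}` — exactly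
  the shape §2 absorbs (`rectangleHolonomy_vec2`, `vec2_add_single_zero/one`: coordinates).

Published forms of the target theorem: Gross–Witten, Phys. Rev. D 21 (1980) 446, §II; Balian–Drouffe–
Itzykson, Phys. Rev. D 11 (1975) 2104; Migdal, Sov. Phys. JETP 42 (1975) 413 (all via gauge fixing or
characters).  Companions in the tree: row 30's `Scaling/PlaquetteIndependence2D` (off a puncture the
plaquettes are i.i.d. Haar — products of functions of single plaquettes; a Wilson loop is not such a
function) and row 5 GEN-12's `SU2OpenRectangleWilsonLoops` (the `SU(2)` case by characters).
No `def`, nothing cited as a fact, 0 sorry.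
-/


noncomputable section

open MeasureTheory Function Finset
open Literature.MathematicalPhysics.QuantumFieldTheory
open Summit.Ventures.LatticeQCDFlow.Theory2.Lattice
open Summit.Ventures.LatticeQCDFlow.Theory2.Lattice.TwoDim

namespace Summit.Ventures.LatticeQCDFlow.Scoring

variable {L : ℕ} [NeZero L] {G : Type*} [Group G] [TopologicalSpace G] [IsTopologicalGroup G]
  [CompactSpace G] [SecondCountableTopology G] [MeasurableSpace G] [BorelSpace G]

/-! ## §1. One-link peeling under product Haar measure -/

/-- Continuous functions on the (compact) configuration space are integrable for product Haar measure. -/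
theorem integrable_gaugeConfig_of_continuous {E : Type*} [NormedAddCommGroup E]
    {F : GaugeConfig 2 L G → E} (hF : Continuous F) :
    Integrable F (Measure.pi fun _ : Edge 2 L => haarProbability G) :=
  hF.integrable_of_hasCompactSupport (HasCompactSupport.of_compactSpace F)

/-- **One-link peeling.**  If `Φ`, `A`, `B` do not depend on the link `e`, then
`∫ f(A U · U_e · B U) Φ(U) dHaar^{⊗E} = (∫ f dHaar) · ∫ Φ dHaar^{⊗E}`: conditionally on the other links,
`A · U_e · B` is Haar distributed (two-sided invariance of the Haar probability of a compact group). -/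
theorem integral_comp_link_mul_eq (e : Edge 2 L) {Φ : GaugeConfig 2 L G → ℂ} (hΦ : Continuous Φ)
    (hΦe : ∀ U g, Φ (update U e g) = Φ U) {A B : GaugeConfig 2 L G → G} (hA : Continuous A)
    (hB : Continuous B) (hAe : ∀ U g, A (update U e g) = A U) (hBe : ∀ U g, B (update U e g) = B U)
    {f : G → ℂ} (hf : Continuous f) :
    ∫ U, f (A U * U e * B U) * Φ U ∂(Measure.pi fun _ : Edge 2 L => haarProbability G) =
      (∫ g, f g ∂(haarProbability G)) *
        ∫ U, Φ U ∂(Measure.pi fun _ : Edge 2 L => haarProbability G) := by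
  have hcont : Continuous fun U : GaugeConfig 2 L G => f (A U * U e * B U) * Φ U :=
    (hf.comp ((hA.mul (continuous_apply e)).mul hB)).mul hΦ
  rw [integral_pi_eq_integral_update (haarProbability G) e (integrable_gaugeConfig_of_continuous hcont)]
  have hinner : ∀ U : GaugeConfig 2 L G,
      (∫ g, f (A (update U e g) * update U e g e * B (update U e g)) * Φ (update U e g)
        ∂(haarProbability G)) = (∫ g, f g ∂(haarProbability G)) * Φ U := by
    intro U
    simp_rw [hΦe, hAe, hBe, update_self]
    rw [integral_mul_const]
    congr 1
    have h1 : (∫ g, f (A U * g * B U) ∂(haarProbability G)) =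
        ∫ g, f (A U * g) ∂(haarProbability G) := by
      simp_rw [mul_assoc]
      exact integral_mul_right_eq_self (fun g => f (A U * g)) (B U)
    rw [h1]
    exact integral_mul_left_eq_self f (A U)
  simp_rw [hinner]
  exact integral_const_mul _ _

/-- One-link peeling, the link entering inverted: `∫ f(A U · U_e⁻¹ · B U) Φ(U) = (∫ f) · ∫ Φ`
(inversion invariance of the Haar probability of a compact group). -/
theorem integral_comp_link_inv_mul_eq (e : Edge 2 L) {Φ : GaugeConfig 2 L G → ℂ} (hΦ : Continuous Φ)
    (hΦe : ∀ U g, Φ (update U e g) = Φ U) {A B : GaugeConfig 2 L G → G} (hA : Continuous A)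
    (hB : Continuous B) (hAe : ∀ U g, A (update U e g) = A U) (hBe : ∀ U g, B (update U e g) = B U)
    {f : G → ℂ} (hf : Continuous f) :
    ∫ U, f (A U * (U e)⁻¹ * B U) * Φ U ∂(Measure.pi fun _ : Edge 2 L => haarProbability G) =
      (∫ g, f g ∂(haarProbability G)) *
        ∫ U, Φ U ∂(Measure.pi fun _ : Edge 2 L => haarProbability G) := by
  have hcont : Continuous fun U : GaugeConfig 2 L G => f (A U * (U e)⁻¹ * B U) * Φ U :=
    (hf.comp ((hA.mul (continuous_apply e).inv).mul hB)).mul hΦ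
  rw [integral_pi_eq_integral_update (haarProbability G) e (integrable_gaugeConfig_of_continuous hcont)]
  have hinner : ∀ U : GaugeConfig 2 L G,
      (∫ g, f (A (update U e g) * (update U e g e)⁻¹ * B (update U e g)) * Φ (update U e g)
        ∂(haarProbability G)) = (∫ g, f g ∂(haarProbability G)) * Φ U := by
    intro U
    simp_rw [hΦe, hAe, hBe, update_self]
    rw [integral_mul_const]
    congr 1
    rw [integral_inv_eq_self (fun g => f (A U * g * B U)) (haarProbability G)]
    have h1 : (∫ g, f (A U * g * B U) ∂(haarProbability G)) =
        ∫ g, f (A U * g) ∂(haarProbability G) := by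
      simp_rw [mul_assoc]
      exact integral_mul_right_eq_self (fun g => f (A U * g)) (B U)
    rw [h1]
    exact integral_mul_left_eq_self f (A U)
  simp_rw [hinner]
  exact integral_const_mul _ _

/-! ## §2. Absorbing a column of conjugated plaquettes into a matrix power -/

/-- **Absorbing a column.**  Let `e_c`, `c < T`, be distinct links ("private links"), and let the
coefficients `A_c, B_c`, the matrix `K` and the scalar `Ψ` be continuous and independent of every private
link.  Then for every continuous representation `ρ` and continuous weight `w`,
`∫ ((∏_{c<T} ρ(A_c U_{e_c} B_c)) · K)_{ab} · (∏_{c<T} w(A_c U_{e_c} B_c)) · Ψ dHaar^{⊗E}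
 = ∫ (M^T · K)_{ab} · Ψ dHaar^{⊗E}`, `M = ∫ ρ(g) w(g) dg` — peel the private links one at a time (§1). -/
theorem integral_listProd_words_mul {N : ℕ} (ρ : G →* Matrix (Fin N) (Fin N) ℂ) (hρ : Continuous ρ)
    {w : G → ℝ} (hw : Continuous w) :
    ∀ (T : ℕ) (e : ℕ → Edge 2 L) (A B : ℕ → GaugeConfig 2 L G → G)
      (K : GaugeConfig 2 L G → Matrix (Fin N) (Fin N) ℂ) (Ψ : GaugeConfig 2 L G → ℂ),
      (∀ c < T, ∀ c' < T, e c = e c' → c = c') →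
      (∀ c, Continuous (A c)) → (∀ c, Continuous (B c)) →
      (∀ c c' U g, A c (update U (e c') g) = A c U) →
      (∀ c c' U g, B c (update U (e c') g) = B c U) →
      Continuous K → (∀ c U g, K (update U (e c) g) = K U) →
      Continuous Ψ → (∀ c U g, Ψ (update U (e c) g) = Ψ U) →
      ∀ a b : Fin N,
        ∫ U, (((List.range T).map fun c => ρ (A c U * U (e c) * B c U)).prod * K U) a b *
            ((∏ c ∈ range T, (w (A c U * U (e c) * B c U) : ℂ)) * Ψ U)
          ∂(Measure.pi fun _ : Edge 2 L => haarProbability G) =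
        ∫ U, ((Matrix.of fun k l : Fin N => ∫ g, ρ g k l * (w g : ℂ) ∂(haarProbability G)) ^ T * K U) a b *
            Ψ U ∂(Measure.pi fun _ : Edge 2 L => haarProbability G) := by
  intro T
  induction T with
  | zero =>
    intro e A B K Ψ _ _ _ _ _ _ _ _ _ a b
    simp
  | succ T ih =>
    intro e A B K Ψ he hA hB hAe hBe hK hKe hΨ hΨe a b
    set M : Matrix (Fin N) (Fin N) ℂ :=
      Matrix.of fun k l : Fin N => ∫ g, ρ g k l * (w g : ℂ) ∂(haarProbability G) with hM
    -- the data of the shorter column `c ↦ c + 1`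
    have he' : ∀ c < T, ∀ c' < T, e (c + 1) = e (c' + 1) → c = c' := fun c hc c' hc' h =>
      Nat.succ_injective (he (c + 1) (by omega) (c' + 1) (by omega) h)
    have hne : ∀ c < T, e (c + 1) ≠ e 0 := fun c hc h =>
      absurd (he (c + 1) (by omega) 0 (by omega) h) (Nat.succ_ne_zero c)
    -- the integrand with the private link `e 0` isolated
    let Φ : Fin N → GaugeConfig 2 L G → ℂ := fun d U =>
      (((List.range T).map fun c => ρ (A (c + 1) U * U (e (c + 1)) * B (c + 1) U)).prod * K U) d b *
        ((∏ c ∈ range T, (w (A (c + 1) U * U (e (c + 1)) * B (c + 1) U) : ℂ)) * Ψ U)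
    have hwords : ∀ c, Continuous fun U : GaugeConfig 2 L G => A c U * U (e c) * B c U :=
      fun c => ((hA c).mul (continuous_apply (e c))).mul (hB c)
    have hΦc : ∀ d, Continuous (Φ d) := by
      intro d
      refine (((continuous_list_prod _ fun c _ => hρ.comp (hwords (c + 1))).matrix_mul hK).matrix_elem
        d b).mul ((continuous_finsetProd _ fun c _ => ?_).mul hΨ)
      exact Complex.continuous_ofReal.comp (hw.comp (hwords (c + 1)))
    have hΦe : ∀ d U g, Φ d (update U (e 0) g) = Φ d U := by
      intro d U g
      have hlist : ((List.range T).map fun c =>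
            ρ (A (c + 1) (update U (e 0) g) * update U (e 0) g (e (c + 1)) * B (c + 1) (update U (e 0) g))) =
          (List.range T).map fun c => ρ (A (c + 1) U * U (e (c + 1)) * B (c + 1) U) := by
        refine List.map_congr_left fun c hc => ?_
        rw [List.mem_range] at hc
        rw [hAe, hBe, update_of_ne (hne c hc)]
      have hprod : (∏ c ∈ range T,
            (w (A (c + 1) (update U (e 0) g) * update U (e 0) g (e (c + 1)) * B (c + 1) (update U (e 0) g)) : ℂ)) =
          ∏ c ∈ range T, (w (A (c + 1) U * U (e (c + 1)) * B (c + 1) U) : ℂ) := by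
        refine Finset.prod_congr rfl fun c hc => ?_
        rw [Finset.mem_range] at hc
        rw [hAe, hBe, update_of_ne (hne c hc)]
      simp only [Φ, hlist, hprod, hKe, hΨe]
    -- pointwise: the integrand is `Σ_d ρ(word₀)_{ad} w(word₀) · Φ_d`
    have hpt : ∀ U : GaugeConfig 2 L G,
        (((List.range (T + 1)).map fun c => ρ (A c U * U (e c) * B c U)).prod * K U) a b *
            ((∏ c ∈ range (T + 1), (w (A c U * U (e c) * B c U) : ℂ)) * Ψ U) =
          ∑ d : Fin N, (ρ (A 0 U * U (e 0) * B 0 U) a d * (w (A 0 U * U (e 0) * B 0 U) : ℂ)) * Φ d U := by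
      intro U
      have hl : ((List.range (T + 1)).map fun c => ρ (A c U * U (e c) * B c U)).prod =
          ρ (A 0 U * U (e 0) * B 0 U) *
            ((List.range T).map fun c => ρ (A (c + 1) U * U (e (c + 1)) * B (c + 1) U)).prod := by
        rw [List.range_succ_eq_map, List.map_cons, List.prod_cons, List.map_map]
        rfl
      rw [hl, Finset.prod_range_succ' (fun c => (w (A c U * U (e c) * B c U) : ℂ)) T, Matrix.mul_assoc,
        Matrix.mul_apply, Finset.sum_mul]
      refine Finset.sum_congr rfl fun d _ => ?_
      simp only [Φ]
      ring
    simp_rw [hpt]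
    have hword0 : Continuous fun U : GaugeConfig 2 L G => ρ (A 0 U * U (e 0) * B 0 U) :=
      hρ.comp (hwords 0)
    have hint0 : ∀ d : Fin N, Integrable (fun U : GaugeConfig 2 L G =>
        ρ (A 0 U * U (e 0) * B 0 U) a d * (w (A 0 U * U (e 0) * B 0 U) : ℂ) * Φ d U)
        (Measure.pi fun _ : Edge 2 L => haarProbability G) := fun d =>
      integrable_gaugeConfig_of_continuous
        (((hword0.matrix_elem a d).mul (Complex.continuous_ofReal.comp (hw.comp (hwords 0)))).mul (hΦc d))
    rw [integral_finsetSum _ fun d _ => hint0 d]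
    have hpeel : ∀ d : Fin N,
        ∫ U, ρ (A 0 U * U (e 0) * B 0 U) a d * (w (A 0 U * U (e 0) * B 0 U) : ℂ) * Φ d U
            ∂(Measure.pi fun _ : Edge 2 L => haarProbability G) =
          M a d * ∫ U, (M ^ T * K U) d b * Ψ U ∂(Measure.pi fun _ : Edge 2 L => haarProbability G) := by
      intro d
      have h := integral_comp_link_mul_eq (e 0) (hΦc d) (hΦe d) (hA 0) (hB 0) (hAe 0 0) (hBe 0 0)
        (f := fun g => ρ g a d * (w g : ℂ)) ((hρ.matrix_elem a d).mul (Complex.continuous_ofReal.comp hw))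
      simp only at h
      rw [h, ih (fun c => e (c + 1)) (fun c => A (c + 1)) (fun c => B (c + 1)) K Ψ he'
          (fun c => hA (c + 1)) (fun c => hB (c + 1)) (fun c c' => hAe (c + 1) (c' + 1))
          (fun c c' => hBe (c + 1) (c' + 1)) hK (fun c => hKe (c + 1)) hΨ (fun c => hΨe (c + 1)) d b]
      simp only [hM, Matrix.of_apply]
    simp_rw [hpeel]
    have hint : ∀ d : Fin N, Integrable (fun U : GaugeConfig 2 L G => (M ^ T * K U) d b * Ψ U)
        (Measure.pi fun _ : Edge 2 L => haarProbability G) := fun d =>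
      integrable_gaugeConfig_of_continuous (((continuous_const.matrix_mul hK).matrix_elem d b).mul hΨ)
    simp_rw [← integral_const_mul]
    rw [← integral_finsetSum _ fun d _ => (hint d).const_mul _]
    have hfin : ∀ U : GaugeConfig 2 L G,
        ∑ d, M a d * ((M ^ T * K U) d b * Ψ U) = (M ^ (T + 1) * K U) a b * Ψ U := by
      intro U
      rw [pow_succ', Matrix.mul_assoc, Matrix.mul_apply, Finset.sum_mul]
      refine Finset.sum_congr rfl fun d _ => ?_
      ring
    exact integral_congr_ae (ae_of_all _ hfin)

/-! ## §3. Lines, sites and the column Stokes identity (pure group algebra) -/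

section Algebra

omit [NeZero L] [TopologicalSpace G] [IsTopologicalGroup G] [CompactSpace G] [SecondCountableTopology G]
  [MeasurableSpace G] [BorelSpace G]

omit [Group G] in
/-- `(i, j) + c·e₀ = (i + c, j)` on `(ℤ/L)²`. -/
theorem vec2_add_single_zero (i j c : ZMod L) : (![i, j] : Site 2 L) + Pi.single 0 c = ![i + c, j] := by
  funext k
  fin_cases k <;> simp

omit [Group G] in
/-- `(i, j) + c·e₁ = (i, j + c)` on `(ℤ/L)²`. -/
theorem vec2_add_single_one (i j c : ZMod L) : (![i, j] : Site 2 L) + Pi.single 1 c = ![i, j + c] := by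
  funext k
  fin_cases k <;> simp

/-- The rectangular loop with corner `(i, j)` in coordinates: bottom line, right line, top line
reversed, left line reversed. -/
theorem rectangleHolonomy_vec2 (U : GaugeConfig 2 L G) (i j : ZMod L) (R T : ℕ) :
    rectangleHolonomy U ![i, j] 0 1 R T =
      lineHolonomy U 0 R ![i, j] * lineHolonomy U 1 T ![i + R, j] *
        (lineHolonomy U 0 R ![i, j + T])⁻¹ * (lineHolonomy U 1 T ![i, j])⁻¹ := by
  unfold rectangleHolonomy
  rw [vec2_add_single_zero, vec2_add_single_one]

/-- **The column Stokes identity.**  Adding the column `a = R` to the `R × T` rectangle with corner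
`(i, j)`: `W_{(R+1)×T} = [∏_{b<T} (P Γ_b h_b) · v'_b · (h_{b+1}⁻¹ v_b⁻¹ Γ_b⁻¹ P⁻¹)] · W_{R×T}`, where
`P` is the bottom line of length `R`, `Γ_b` the left line of the column of height `b`, `h_b` the
horizontal link at `(i+R, j+b)`, `v_b` / `v'_b` the left / right vertical links of the plaquette at
`(i+R, j+b)` — each factor is that plaquette's holonomy transported to the corner,
`(P Γ_b) U_{(i+R, j+b)} (P Γ_b)⁻¹`, written as a word in its RIGHT link `v'_b = U_{(i+R+1, j+b), 1}`. -/
theorem rectangleHolonomy_succ_eq_listProd_mul (U : GaugeConfig 2 L G) (i j : ZMod L) (R T : ℕ) :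
    rectangleHolonomy U ![i, j] 0 1 (R + 1) T =
      ((List.range T).map fun b : ℕ =>
          lineHolonomy U 0 R ![i, j] * lineHolonomy U 1 b ![i + R, j] * U (![i + R, j + b], 0) *
            U (![i + R + 1, j + b], 1) *
            ((U (![i + R, j + b + 1], 0))⁻¹ * (U (![i + R, j + b], 1))⁻¹ *
              (lineHolonomy U 1 b ![i + R, j])⁻¹ * (lineHolonomy U 0 R ![i, j])⁻¹)).prod *
        rectangleHolonomy U ![i, j] 0 1 R T := by
  -- the boundary of the column of height `n`, transported to the corner, is the product of its
  -- transported plaquettes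
  have key : ∀ n : ℕ,
      lineHolonomy U 0 R ![i, j] *
          (U (![i + R, j], 0) * lineHolonomy U 1 n ![i + R + 1, j] * (U (![i + R, j + n], 0))⁻¹ *
            (lineHolonomy U 1 n ![i + R, j])⁻¹) * (lineHolonomy U 0 R ![i, j])⁻¹ =
        ((List.range n).map fun b : ℕ =>
          lineHolonomy U 0 R ![i, j] * lineHolonomy U 1 b ![i + R, j] * U (![i + R, j + b], 0) *
            U (![i + R + 1, j + b], 1) *
            ((U (![i + R, j + b + 1], 0))⁻¹ * (U (![i + R, j + b], 1))⁻¹ *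
              (lineHolonomy U 1 b ![i + R, j])⁻¹ * (lineHolonomy U 0 R ![i, j])⁻¹)).prod := by
    intro n
    induction n with
    | zero => simp
    | succ n ih =>
      rw [List.range_succ, List.map_append, List.prod_append, List.map_singleton, List.prod_singleton,
        ← ih, lineHolonomy_succ_right U 1 n ![i + R + 1, j], lineHolonomy_succ_right U 1 n ![i + R, j],
        vec2_add_single_one, vec2_add_single_one]
      push_cast
      simp only [add_assoc]
      group
  rw [rectangleHolonomy_vec2, rectangleHolonomy_vec2, ← key T, lineHolonomy_succ_right U 0 R ![i, j],
    lineHolonomy_succ_right U 0 R ![i, j + T], vec2_add_single_zero, vec2_add_single_zero]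
  push_cast
  simp only [add_assoc]
  group

end Algebra

end Summit.Ventures.LatticeQCDFlow.Scoring
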